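/-
Copyright (c) 2026 the pub-hodgecm-mathlib formalisation cell (harness21).  Prover seat hodgecm-mathlib-LH4-p17 (g0), req620 Track A «(D-RAM) FOUR-FRAME» squad, helper lane on
h413 = stmt-HodgeConjecture-24833 (count-neutral).  β-BOARD v1 (sub-dealer LH4-p05 (g8)) row R3 «G₁ ε-BOUNDARY TOWER FILE» — the orbit kit of the head (shell, representatives, decomposition,
ratio, per-orbit value).  2026-09-04.
-/
import Summits.HodgeConjecture.HodgeConjecture.Theorems.F0P3cDyRamLabelledOddGluedRepBeyond       -- ★ p861666 (this seat, FILE 5a): the per-orbit value; brings ★ p861456, ★ p861560, ★ p13 glued read, ★ equivariance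
import Summits.HodgeConjecture.HodgeConjecture.Theorems.F0P3cDyRamLabelledOddGluedDecomposition    -- ★ (LH7-p05 (g0)): `finsum_labelledOdd_div_relIndex_glued_sep_eq`
import Summits.HodgeConjecture.HodgeConjecture.Theorems.F0P3cDyRamLabelledOddPureStrataG1          -- ★ p860827 (LH4-p11 (g8)): the cell column's kit — brings ★ `stratum_G1_eq`, ★ G1 token reads, ★ `finite_unitTorus_orbit_…`, ★ `v_diag_eq_one`
import Summits.HodgeConjecture.HodgeConjecture.Theorems.F0P3cDyRamStageOneBDerivedDefs             -- ★ p859675: `n0DerivedOfRecord`, `mcOfRecord_le_n0DerivedOfRecord`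
import Summits.HodgeConjecture.HodgeConjecture.Theorems.F0P3cDyRamDiagonalKappaCoreHangingClass     -- ★: `two_le_d_of_v_two_lt_one`
import Summits.HodgeConjecture.HodgeConjecture.Theorems.F0P3cDyRamLevelCountDiagonalModel          -- ★: `latticeInLevel_diagonal_mapGL_iff`
import HarnessLib

/-!
# Crux `H413`, line LH4 «(D-RAM) FOUR-FRAME» — (β) Stage B, β-BOARD R3 (kit): THE `G₁ = (2ρ, 2ρ+s, 2ρ+s)` CAPPED TUBE CLASSES BEYOND THE ONE-SLOT CELL —
# shell, representatives, decomposition over the orbits, the ratio of the approximants, the per-orbit value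

Cell `hodgecm-mathlib` (D-0151), FLOOR 0, crux item H413 = `stmt-HodgeConjecture-24833`, route `HCCMUnconditional`; squad F0∕P3c∕LH4.  THEOREMS ONLY (no `def`, no instance, no
notation, no `sorry`, default heartbeats); ★-only imports; lane `--supports stmt-HodgeConjecture-24833 --as helper` (count-neutral); pays NO row, states NO law.  This is the orbit kit
of the R3 head `F0P3cDyRamLabelledOddBoundaryG1.finsum_stratum_G1_beyond_shell_labelledOdd_div_relIndex_eq` (the `hP3G1` letter of (T2) `hbox_of_oddBoxSum` ∕ (T1) ★ p861261 `hG1b`):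
§1 under the read `2ρ+s+ℓ₀ = n₁` and the cap every member of the stratum is on the clean shell (★ G1 token reads off the glue foot); §2 every representative `latt V(1,1,g)` is in the
stratum and `T`-stable on the tube; §3 the labelled table of the capped tube class is `|𝒯-orbit| · Σ_{g ∈ R}` of the per-representative values (★ `stratum_G1_eq`, ★ LH7-p05);
§4 the ratio `r = g_α∕g_β` of the approximants (`g_β = e_B·π₀^{ρ+s∕2}`, `g_α` from ★ p13), with `|rg| = |ϖ|^{n₂−ℓ₀−2ρ}` exactly and the two regimes of `|r − 1|`; §5 the per-orbit
value (★ FILE 5a p861666) and `ω(e_B·π₀^k·x) = ω(e_B)ω(x)`.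
HONEST LABEL.  Count-neutral helpers; `HC_CM` is proved only modulo the 7 printed citations (2 remaining named inputs: hLiu418 = `stmt-HodgeConjecture-24832`, h413 =
`stmt-HodgeConjecture-24833`) until rung 0 closes.
References: [Kottwitz1986BaseChangeUnits] §1 pp. 240–241 · [Rogawski1990] §4.9 Prop. 4.9.1 (a)(b) p. 55 · [LanglandsShelstad1987] §3 · [Serre1979] Ch. V §3, Ch. XV §2.
-/

set_option autoImplicit false

noncomputable section

namespace Summit.HodgeConjecture.HodgeConjecture.Cruxes.H413.F0P3cDyRamLabelledOddBoundaryG1Orbits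

open Matrix WithZero
open Literature.NumberTheory.Automorphic Literature.NumberTheory.Automorphic.HermitianLattice Literature.NumberTheory.Automorphic.UnitaryGroup
open Literature.NumberTheory.Automorphic.UnitaryLatticeTree Literature.NumberTheory.Automorphic.UnitaryThreeFourFrame
open Literature.NumberTheory.LocalFields Literature.NumberTheory.LocalFields.WildQuadraticDatum
open Summit.HodgeConjecture.HodgeConjecture.Cruxes.H413.F0P3cDyRamFourFramePieces
open Summit.HodgeConjecture.HodgeConjecture.Cruxes.H413.F0P3cDyRamFourFrameCensusDefs
open Summit.HodgeConjecture.HodgeConjecture.Cruxes.H413.F0P3cDyRamStageOneBDefs (mcOfRecord)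
open Summit.HodgeConjecture.HodgeConjecture.Cruxes.H413.F0P3cDyRamStageOneBDerivedDefs (n0DerivedOfRecord mcOfRecord_le_n0DerivedOfRecord)
open Summit.HodgeConjecture.HodgeConjecture.Cruxes.H413.F0P3cDyRamDiagonalTorusDefs
open Summit.HodgeConjecture.HodgeConjecture.Cruxes.H413.F0P3cDyRamDiagonalStrataDefs
open Summit.HodgeConjecture.HodgeConjecture.Cruxes.H413.F0P3cDyRamDiagonalKappaCountDefs
open Summit.HodgeConjecture.HodgeConjecture.Cruxes.H413.F0P3cDyRamLabelledOddCountDefs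
open Summit.HodgeConjecture.HodgeConjecture.Cruxes.H413.F0P3cDyRamDiagonalGluedStratum (stratum_G1_eq)
open Summit.HodgeConjecture.HodgeConjecture.Cruxes.H413.F0P3cDyRamLabelledGluedStratumRead (latticeInLevel_diagonal_latt_G1_iff latticeInLevel_diagonal_latt_G1_iff_of_ne)
open Summit.HodgeConjecture.HodgeConjecture.Cruxes.H413.F0P3cDyRamStableCountTypeZero (v_diag_eq_one diag_regular)
open Summit.HodgeConjecture.HodgeConjecture.Cruxes.H413.F0P3cDyRamDiagonalOrbitFibreCountHeads (finite_unitTorus_orbit_of_mem_normalisedStableLattices)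
open Summit.HodgeConjecture.HodgeConjecture.Cruxes.H413.F0P3cDyRamDiagonalGluedStabiliserIndex (stabiliserWeight_latt_glued_tube_eq ne_zero_and_v_lt_one_of_v_eq_exp)
open Summit.HodgeConjecture.HodgeConjecture.Cruxes.H413.F0P3cDyRamDiagonalKappaGluedDecomposition (mapGL_latt_glued_rep_of_depths)
open Summit.HodgeConjecture.HodgeConjecture.Cruxes.H413.F0P3cDyRamDiagonalKappaGluedClassForm (isVertexLattice_zero_latt_glued_rep)
open Summit.HodgeConjecture.HodgeConjecture.Cruxes.H413.F0P3cDyRamLabelledOddGluedDecomposition (finsum_labelledOdd_div_relIndex_glued_sep_eq)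
open Summit.HodgeConjecture.HodgeConjecture.Cruxes.H413.F0P3cDyRamValueClassLabelEquivariant (isTorusEquivariantLabel_valueClassLabel)
open Summit.HodgeConjecture.HodgeConjecture.Cruxes.H413.F0P3cDyRamLevelCountDiagonalModel (latticeInLevel_diagonal_mapGL_iff)
open Summit.HodgeConjecture.HodgeConjecture.Cruxes.H413.F0P3cDyRamDiagonalKappaCoreHangingClass (two_le_d_of_v_two_lt_one)
open Summit.HodgeConjecture.HodgeConjecture.Cruxes.H413.F0P3cDyRamFixedCountDiagonalModel (normSign_mul_norm)
open Summit.HodgeConjecture.HodgeConjecture.Cruxes.H413.F0P3cDyRamTwoSlotLabelRead (exists_fixed_mul_refSkew_near_sub_one)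
open Summit.HodgeConjecture.HodgeConjecture.Cruxes.H413.F0P3cDyRamLabelledOddGluedRepBeyond (labelledOdd_div_relIndex_glued_rep_beyond_eq)
open scoped Valued WithZero Matrix MatrixGroups

variable {K : Type} [Field K] [Valued K ℤᵐ⁰] [CompleteSpace K] [Fintype 𝓀[K]] {σ : K →+* K} {ϖ : K} {d t : ℕ} {α β : K} {n₁ n₂ n₃ : ℕ}

/-! ## §1  Beyond the cell, under the read and the cap, the whole stratum is on the clean shell -/

omit [CompleteSpace K] [Fintype 𝓀[K]] in
/-- **THE CLEAN SHELL BEYOND THE CELL** (token-free): under the read `2ρ + s + ℓ₀ = n₁` and the cap `2ρ + 2 + ℓ₀ ≤ min n₂ n₃`, every member of the stratum `(2ρ, 2ρ+s, 2ρ+s)` carries the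
three clean-shell tokens of `X = diag(α−1, β−1, 0)` (levels `ℓ₀`, not `ℓ₀+1`, square at `mcOfRecord d`) — the stratum is off the glue foot (`n₂ + s ≥ n₁ + 2`), so ★ p859257's
constant reads apply verbatim. [cite: Kottwitz1986BaseChangeUnits, §1 pp. 240–241] [cite: Rogawski1990, §4.9 Prop. 4.9.1 (a) p. 55] -/
theorem shell_of_mem_stratum_G1_beyond (hD : IsRamifiedQuadraticDatum σ ϖ d t) (hE : IsElementDatum σ ϖ (n0DerivedOfRecord d) α β n₁ n₂ n₃)
    (T : GL (Fin 3) K) (ρ s : ℕ) (hρ : 1 ≤ ρ) (hs : 1 ≤ s)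
    (hread : 2 * ρ + s + d % 2 = n₁) (hcap : 2 * ρ + 2 + d % 2 ≤ min n₂ n₃)
    {M : Submodule 𝒪[K] (Fin 3 → K)} (hM : M ∈ stratum σ ϖ T ![2 * ρ, 2 * ρ + s, 2 * ρ + s]) :
    LatticeInLevel ϖ (d % 2) (Matrix.diagonal ![α - 1, β - 1, 0]) M ∧ ¬ LatticeInLevel ϖ (d % 2 + 1) (Matrix.diagonal ![α - 1, β - 1, 0]) M ∧
      LatticeInLevel ϖ (mcOfRecord d) (Matrix.diagonal ![(α - 1) * (α - 1), (β - 1) * (β - 1), 0]) M := by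
  classical
  obtain ⟨hσ, hvσ, hϖ, hfix, -, -, -⟩ := id hD
  have hϖ0 : ϖ ≠ 0 := fun h0 => by rw [h0, map_zero] at hϖ; exact WithZero.coe_ne_zero hϖ.symm
  have hα : Valued.v (α - 1) = Valued.v ϖ ^ n₂ := hE.2.2.2.2.2.2.1
  have hβ : Valued.v (β - 1) = Valued.v ϖ ^ n₁ := hE.2.2.2.2.2.1
  have hγ : Valued.v (α - β) = Valued.v ϖ ^ n₃ := hE.2.2.2.2.2.2.2.1
  have hn₁ : n0DerivedOfRecord d ≤ n₁ := hE.2.2.2.2.2.2.2.2.1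
  have hn₂ : n0DerivedOfRecord d ≤ n₂ := hE.2.2.2.2.2.2.2.2.2.1
  have hmcN : mcOfRecord d ≤ n0DerivedOfRecord d := mcOfRecord_le_n0DerivedOfRecord d
  have hmcv : mcOfRecord d = 2 * ((d % 2 + 2 * d - 1 + d) / 2) := rfl
  have hγ' : Valued.v (β - 1 - (α - 1)) = Valued.v ϖ ^ n₃ := by rw [show β - 1 - (α - 1) = -(α - β) by ring, Valuation.map_neg, hγ]
  have hv0 : ∀ ℓ : ℕ, Valued.v (0 : K) ≤ Valued.v ϖ ^ ℓ := fun ℓ => by rw [map_zero]; exact zero_le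
  have hpw : ∀ a b : ℕ, Valued.v ϖ ^ a ≤ Valued.v ϖ ^ b ↔ b ≤ a := fun a b => by
    rw [v_varpi_pow hϖ, v_varpi_pow hϖ, WithZero.exp_le_exp]; omega
  have hA2 : Valued.v ((α - 1) * (α - 1)) = Valued.v ϖ ^ (2 * n₂) := by rw [map_mul, hα, ← pow_add, two_mul]
  have hB2 : Valued.v ((β - 1) * (β - 1)) = Valued.v ϖ ^ (2 * n₁) := by rw [map_mul, hβ, ← pow_add, two_mul]
  rw [stratum_G1_eq hvσ hfix hϖ T hρ hs] at hM
  obtain ⟨x, ζ, y'', hx, hζ, hy, rfl, -, -⟩ := hM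
  have hgen := fun (ℓ : ℕ) (e : Fin 3 → K) => latticeInLevel_diagonal_latt_G1_iff hϖ0 ℓ ρ s e hx hζ y''
  -- the square token (general read, both cross terms small)
  have hsq : LatticeInLevel ϖ (mcOfRecord d) (Matrix.diagonal ![(α - 1) * (α - 1), (β - 1) * (β - 1), 0])
      (latt (!![1, 0, 0; x, ϖ ^ ρ, 0; x * ζ + y'', ϖ ^ ρ * ζ, ϖ ^ (2 * ρ + s)] : Matrix (Fin 3) (Fin 3) K)) := by
    rw [hgen]
    simp only [Matrix.cons_val_zero, Matrix.cons_val_one, Matrix.cons_val_two, Matrix.tail_cons, Matrix.head_cons, zero_sub, mul_neg, neg_mul, Valuation.map_neg, map_zero, zero_le, and_true]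
    refine ⟨⟨?_, ?_⟩, ?_, ?_, ?_⟩
    · rw [hA2, hpw]; omega
    · rw [hB2, hpw]; omega
    · refine (Valuation.map_sub _ _ _).trans (max_le ?_ ?_)
      · rw [hB2, hpw]; omega
      · rw [hA2, hpw]; omega
    · rw [hB2, hpw]; omega
    · refine (Valuation.map_add _ _ _).trans (max_le ?_ ?_)
      · rw [Valuation.map_neg, map_mul, map_mul, hx, hζ, one_mul, one_mul, hB2, hpw]; omega
      · rw [Valuation.map_neg, map_mul, hA2, hy, ← pow_add, hpw]; omega
  -- off the foot: the two level tokens read constants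
  have hne : Valued.v ((![α - 1, β - 1, 0] : Fin 3 → K) 2 - (![α - 1, β - 1, 0] : Fin 3 → K) 1) ≠
      Valued.v ((![α - 1, β - 1, 0] : Fin 3 → K) 2 - (![α - 1, β - 1, 0] : Fin 3 → K) 0) * Valued.v ϖ ^ s := by
    simp only [Matrix.cons_val_zero, Matrix.cons_val_one, Matrix.cons_val_two, Matrix.tail_cons, Matrix.head_cons, zero_sub, Valuation.map_neg, hα, hβ, ← pow_add]
    rw [v_varpi_pow hϖ, v_varpi_pow hϖ, Ne, WithZero.exp_inj]; omega
  rw [latticeInLevel_diagonal_latt_G1_iff_of_ne hϖ0 (d % 2) ρ s _ hx hζ hy hne, latticeInLevel_diagonal_latt_G1_iff_of_ne hϖ0 (d % 2 + 1) ρ s _ hx hζ hy hne]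
  simp only [Matrix.cons_val_zero, Matrix.cons_val_one, Matrix.cons_val_two, Matrix.tail_cons, Matrix.head_cons, zero_sub, Valuation.map_neg, hv0, and_true, hγ', hsq, hα, hβ, ← pow_add, hpw]
  refine ⟨⟨⟨by omega, by omega⟩, by omega, by omega, by omega, by omega⟩, ?_⟩
  rintro ⟨⟨-, -⟩, -, -, h1, -⟩
  omega

/-! ## §2  The representatives lie in the stratum and are `T`-stable on the tube -/

omit [CompleteSpace K] [Fintype 𝓀[K]] in
/-- **EVERY REPRESENTATIVE `latt V(1,1,g)` IS IN THE STRATUM AND `T`-STABLE** on the tube beyond the cell (dualisable by ★ κG-A1's explicit polarisation; stable by ★ B5 (ii)).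
[cite: Kottwitz1986BaseChangeUnits, §1 pp. 240–241] -/
theorem latt_glued_rep_mem_stratum_beyond (hD : IsRamifiedQuadraticDatum σ ϖ d t) (hE : IsElementDatum σ ϖ (n0DerivedOfRecord d) α β n₁ n₂ n₃)
    (T : GL (Fin 3) K) (hT : (T : Matrix (Fin 3) (Fin 3) K) = Matrix.diagonal ![α, β, 1]) (ρ t' : ℕ) (hρ : 1 ≤ ρ) (ht' : 1 ≤ t')
    (hread : 2 * ρ + 2 * t' + d % 2 = n₁) (hcap : 2 * ρ + 2 + d % 2 ≤ min n₂ n₃)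
    {g : K} (hσg : σ g = g) (hg : Valued.v g = Valued.v ϖ ^ (2 * t'))
    (V : GL (Fin 3) K) (hV : (V : Matrix (Fin 3) (Fin 3) K) = !![1, 0, 0; 1, ϖ ^ ρ, 0; 1 * 1 + g, ϖ ^ ρ * 1, ϖ ^ (2 * ρ + 2 * t')]) :
    mapGL T (latt (V : Matrix (Fin 3) (Fin 3) K)) = latt (V : Matrix (Fin 3) (Fin 3) K) ∧
      latt (V : Matrix (Fin 3) (Fin 3) K) ∈ stratum σ ϖ T ![2 * ρ, 2 * ρ + 2 * t', 2 * ρ + 2 * t'] := by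
  obtain ⟨hσ, hvσ, hϖ, hfix, -, -, -⟩ := id hD
  obtain ⟨hϖ0, hϖ1⟩ := ne_zero_and_v_lt_one_of_v_eq_exp hϖ
  have hvϖ : 0 < Valued.v ϖ := (Valuation.pos_iff _).2 hϖ0
  have hσϖ0 : σ ϖ ≠ 0 := (map_ne_zero σ).2 hϖ0
  obtain ⟨hαn, hβn, -, -, -, h₁, h₂, h₃, hN1, hN2, hN3⟩ := id hE
  have hαv := UnitaryThreeFourFrame.v_eq_one_of_mul_map_eq_one hvσ hαn
  have hβv := UnitaryThreeFourFrame.v_eq_one_of_mul_map_eq_one hvσ hβn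
  have h₃' : Valued.v (β - α) = Valued.v ϖ ^ n₃ := by rw [Valuation.map_sub_swap, h₃]
  have hstab : mapGL T (latt (V : Matrix (Fin 3) (Fin 3) K)) = latt (V : Matrix (Fin 3) (Fin 3) K) :=
    mapGL_latt_glued_rep_of_depths hϖ0 hϖ1.le hαv hβv T hT h₁ h₂ h₃' (by omega) (by omega) (by omega) hg V hV
  refine ⟨hstab, ?_⟩
  rw [stratum_G1_eq hvσ hfix hϖ T hρ (by omega : 1 ≤ 2 * t')]
  refine ⟨1, 1, g, by simp, by simp, hg, by rw [hV], hstab, ?_⟩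
  have hπ0 : ((ϖ * σ ϖ) ^ (ρ + t') : K) ≠ 0 := pow_ne_zero _ (mul_ne_zero hϖ0 hσϖ0)
  have hσπ : σ ((ϖ * σ ϖ) ^ (ρ + t')) = (ϖ * σ ϖ) ^ (ρ + t') := by rw [map_pow, map_mul, hσ, mul_comm]
  have hg0 : g ≠ 0 := fun h => by rw [h, map_zero] at hg; exact (pow_ne_zero _ hvϖ.ne') hg.symm
  have h1g : Valued.v (1 + g) = 1 := Valued.v.map_one_add_of_lt (by rw [hg]; exact pow_lt_one₀ zero_le hϖ1 (by omega))
  have h1g0 : (1 : K) + g ≠ 0 := fun h => by rw [h, map_zero] at h1g; exact zero_ne_one h1g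
  have hσ1g : σ (1 + g) = 1 + g := by rw [map_add, map_one, hσg]
  refine ⟨![((ϖ * σ ϖ) ^ (ρ + t'))⁻¹ * g, ((ϖ * σ ϖ) ^ (ρ + t'))⁻¹, -(((ϖ * σ ϖ) ^ (ρ + t'))⁻¹ * (1 + g)⁻¹)], fun k => ?_,
    isVertexLattice_zero_latt_glued_rep hσ hvσ hϖ0 hϖ1 ρ t' hσg hg ht' V hV⟩
  fin_cases k
  · simp only [Fin.zero_eta, Fin.isValue, Matrix.cons_val_zero]
    exact ⟨by rw [map_mul, map_inv₀, hσπ, hσg], mul_ne_zero (inv_ne_zero hπ0) hg0⟩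
  · simp only [Fin.mk_one, Fin.isValue, Matrix.cons_val_one, Matrix.cons_val_zero]
    exact ⟨by rw [map_inv₀, hσπ], inv_ne_zero hπ0⟩
  · simp only [Fin.reduceFinMk, Matrix.cons_val_two, Matrix.tail_cons, Matrix.head_cons]
    exact ⟨by rw [map_neg, map_mul, map_inv₀, map_inv₀, hσπ, hσ1g], neg_ne_zero.2 (mul_ne_zero (inv_ne_zero hπ0) (inv_ne_zero h1g0))⟩

/-! ## §3  The decomposition of the beyond-the-cell table over the representatives -/

omit [CompleteSpace K] in
/-- **THE TABLE OF THE CAPPED TUBE CLASS, OVER THE REPRESENTATIVES**: for any complete irredundant system `R` of the orbit parameters and reference frames `V₀ g = V(1,1,g)`,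
`Σᶠ_{M ∈ stratum, shell} m^Λ_i(M)∕[𝒰:N(S̃′(M))] = |𝒯-orbit| · Σ_{g ∈ R} m^Λ_i(latt V₀ g)∕[𝒰:N(S̃′(latt V₀ g))]` (★ `stratum_G1_eq` ∘ ★ LH7-p05 `finsum_labelledOdd_div_relIndex_glued_sep_eq`;
every representative is stable and on the shell, §1–§2). [cite: Kottwitz1986BaseChangeUnits, §1 pp. 240–241] [cite: Rogawski1990, §4.9 Prop. 4.9.1 (a) p. 55] -/
theorem finsum_beyond_eq_card_mul_sum (h2 : Valued.v (2 : K) < 1) (hD : IsRamifiedQuadraticDatum σ ϖ d t)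
    (hE : IsElementDatum σ ϖ (n0DerivedOfRecord d) α β n₁ n₂ n₃)
    (T : GL (Fin 3) K) (hT : (T : Matrix (Fin 3) (Fin 3) K) = Matrix.diagonal ![α, β, 1]) (ρ t' : ℕ) (hρ : 1 ≤ ρ) (ht' : 1 ≤ t')
    (hread : 2 * ρ + 2 * t' + d % 2 = n₁) (hcap : 2 * ρ + 2 + d % 2 ≤ min n₂ n₃)
    (R : Finset K) (hR1' : ∀ g ∈ R, σ g = g ∧ Valued.v g = Valued.v ϖ ^ (2 * t'))
    (hR2' : ∀ f : K, σ f = f → Valued.v f = Valued.v ϖ ^ (2 * t') → ∃ g ∈ R, Valued.v (f - g) ≤ Valued.v ϖ ^ (ρ + 2 * t'))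
    (hR3' : ∀ g ∈ R, ∀ g' ∈ R, Valued.v (g - g') ≤ Valued.v ϖ ^ (ρ + 2 * t') → g = g')
    (V₀ : K → GL (Fin 3) K) (hV₀ : ∀ g, (V₀ g : Matrix (Fin 3) (Fin 3) K) = !![1, 0, 0; 1, ϖ ^ ρ, 0; 1 * 1 + g, ϖ ^ ρ * 1, ϖ ^ (2 * ρ + 2 * t')]) (i : Fin 3) :
    ∑ᶠ M ∈ {M : Submodule 𝒪[K] (Fin 3 → K) | M ∈ stratum σ ϖ T ![2 * ρ, 2 * ρ + 2 * t', 2 * ρ + 2 * t'] ∧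
        (LatticeInLevel ϖ (d % 2) (Matrix.diagonal ![α - 1, β - 1, 0]) M ∧ ¬ LatticeInLevel ϖ (d % 2 + 1) (Matrix.diagonal ![α - 1, β - 1, 0]) M ∧
          LatticeInLevel ϖ (mcOfRecord d) (Matrix.diagonal ![(α - 1) * (α - 1), (β - 1) * (β - 1), 0]) M)},
      (labelledOddCount σ ϖ 0 i (valueClassLabel σ ϖ (α - 1) (β - 1) (d % 2 + 2 * d - 1) d) M : ℚ) /
        ((((unitStabilizer M).map (unitNormMap σ 3)).relIndex (fixedUnitTorus σ 3) : ℕ) : ℚ) =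
      ((((Nat.card 𝓀[K] - 1) * Nat.card 𝓀[K] ^ (ρ + 2 * t' - 1)) * ((Nat.card 𝓀[K] - 1) * Nat.card 𝓀[K] ^ (2 * ρ - 1)) : ℕ) : ℚ) *
        ∑ g ∈ R, (labelledOddCount σ ϖ 0 i (valueClassLabel σ ϖ (α - 1) (β - 1) (d % 2 + 2 * d - 1) d) (latt (V₀ g : Matrix (Fin 3) (Fin 3) K)) : ℚ) /
            ((((unitStabilizer (latt (V₀ g : Matrix (Fin 3) (Fin 3) K))).map (unitNormMap σ 3)).relIndex (fixedUnitTorus σ 3) : ℕ) : ℚ) := by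
  classical
  have hTr := trace_bound_of_isRamifiedQuadraticDatum hD h2
  obtain ⟨hσ, hvσ, hϖ, hfix, -, -, -⟩ := id hD
  have hs : 1 ≤ 2 * t' := by omega
  have hP : ∀ u ∈ unitTorus K 3, ∀ M : Submodule 𝒪[K] (Fin 3 → K),
      (LatticeInLevel ϖ (d % 2) (Matrix.diagonal ![α - 1, β - 1, 0]) (mapGL (diagGLUnits u) M) ∧
          ¬ LatticeInLevel ϖ (d % 2 + 1) (Matrix.diagonal ![α - 1, β - 1, 0]) (mapGL (diagGLUnits u) M) ∧
            LatticeInLevel ϖ (mcOfRecord d) (Matrix.diagonal ![(α - 1) * (α - 1), (β - 1) * (β - 1), 0]) (mapGL (diagGLUnits u) M)) ↔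
        (LatticeInLevel ϖ (d % 2) (Matrix.diagonal ![α - 1, β - 1, 0]) M ∧ ¬ LatticeInLevel ϖ (d % 2 + 1) (Matrix.diagonal ![α - 1, β - 1, 0]) M ∧
          LatticeInLevel ϖ (mcOfRecord d) (Matrix.diagonal ![(α - 1) * (α - 1), (β - 1) * (β - 1), 0]) M) := fun u _ M => by
    rw [latticeInLevel_diagonal_mapGL_iff (coe_diagGLUnits u), latticeInLevel_diagonal_mapGL_iff (coe_diagGLUnits u),
      latticeInLevel_diagonal_mapGL_iff (coe_diagGLUnits u)]
  rw [stratum_G1_eq hvσ hfix hϖ T hρ hs,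
    finsum_labelledOdd_div_relIndex_glued_sep_eq hσ hvσ hϖ hTr T hT ρ t' hρ ht' R hR1' hR2' hR3' V₀ hV₀ 0 i
      (isTorusEquivariantLabel_valueClassLabel σ ϖ (α - 1) (β - 1) (d % 2 + 2 * d - 1) d) _ hP,
    Finset.sum_filter, Finset.sum_congr rfl (fun g hg => by
      obtain ⟨hstab, hmem⟩ := latt_glued_rep_mem_stratum_beyond hD hE T hT ρ t' hρ ht' hread hcap (hR1' g hg).1 (hR1' g hg).2 (V₀ g) (hV₀ g)
      rw [if_pos ⟨hstab, shell_of_mem_stratum_G1_beyond hD hE T ρ (2 * t') hρ hs hread hcap hmem⟩])]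

/-! ## §4  The ratio `r = g_α ∕ g_β` of the approximants and its sizes -/

omit [CompleteSpace K] [Fintype 𝓀[K]] in
/-- **THE RATIO OF THE APPROXIMANTS.**  With `g_β := e_B·π₀^{ρ+t′}` and `g_α` from ★ p13 `exists_fixed_mul_refSkew_near_sub_one` at precision `m* + 2ρ`: a fixed `r = g_α∕g_β` with
(i) the read precision of `g_α = r·g_β` at `π₀^{−(ρ+t′)}g` for every orbit parameter `g`, (ii) `|rg| = |ϖ|^{n₂−ℓ₀−2ρ}` EXACTLY (beyond the cell `|g_α t₊| = |α − 1|`), (iii) `|r−1|·|ϖ|^{2t′} =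
|ϖ|^{n₃−ℓ₀−2ρ}` if `n₃ < m* + 2ρ` (the `α − β` term dominates `(g_α − g_β)t₊`) and `≤ |ϖ|^{2d−1}` otherwise. [cite: Rogawski1990, §4.9 Prop. 4.9.1 (b) p. 55] [cite: Serre1979, Ch. XV §2] -/
theorem exists_ratio_beyond (hD : IsRamifiedQuadraticDatum σ ϖ d t) (hE : IsElementDatum σ ϖ (n0DerivedOfRecord d) α β n₁ n₂ n₃) (ρ t' : ℕ) (ht' : 1 ≤ t')
    (hbey : n₂ < 2 * ρ + (d % 2 + 2 * d - 1)) (hread : 2 * ρ + 2 * t' + d % 2 = n₁) (hcap : 2 * ρ + 2 + d % 2 ≤ min n₂ n₃)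
    {eB : K} (hσeB : σ eB = eB) (heB1 : Valued.v eB = 1)
    (heB : Valued.v ((ϖ ^ (d % 2 + 2 * d - 1))⁻¹ * ((β - 1) * ((ϖ * σ ϖ) ^ (ρ + t'))⁻¹ - eB * ((ϖ - σ ϖ) * ((ϖ * σ ϖ) ^ ((d - d % 2) / 2))⁻¹))) ≤ 1) :
    ∃ r : K, σ r = r ∧
      Valued.v ((ϖ ^ (d % 2 + 2 * d - 1))⁻¹ * (((ϖ * σ ϖ) ^ (ρ + t'))⁻¹ *
        ((β - 1) - (eB * (ϖ * σ ϖ) ^ (ρ + t')) * ((ϖ - σ ϖ) * ((ϖ * σ ϖ) ^ ((d - d % 2) / 2))⁻¹)))) ≤ 1 ∧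
      (∀ g : K, Valued.v g = Valued.v ϖ ^ (2 * t') →
        Valued.v ((ϖ ^ (d % 2 + 2 * d - 1))⁻¹ * (((ϖ * σ ϖ) ^ (ρ + t'))⁻¹ * g *
          ((α - 1) - r * (eB * (ϖ * σ ϖ) ^ (ρ + t')) * ((ϖ - σ ϖ) * ((ϖ * σ ϖ) ^ ((d - d % 2) / 2))⁻¹)))) ≤ 1 ∧
        Valued.v (r * g) = Valued.v ϖ ^ (n₂ - d % 2 - 2 * ρ)) ∧
      Valued.v r * Valued.v ϖ ^ (2 * t') = Valued.v ϖ ^ (n₂ - d % 2 - 2 * ρ) ∧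
      (n₃ < d % 2 + 2 * d - 1 + 2 * ρ → Valued.v (r - 1) * Valued.v ϖ ^ (2 * t') = Valued.v ϖ ^ (n₃ - d % 2 - 2 * ρ)) ∧
      (d % 2 + 2 * d - 1 + 2 * ρ ≤ n₃ → Valued.v (r - 1) * Valued.v ϖ ^ (2 * t') ≤ Valued.v ϖ ^ (2 * d - 1)) := by
  obtain ⟨hσ, hvσ, hϖ, hfix, hdd, hd1, ht₂⟩ := id hD
  obtain ⟨hϖ0, hϖ1⟩ := ne_zero_and_v_lt_one_of_v_eq_exp hϖ
  have hvϖ : 0 < Valued.v ϖ := (Valuation.pos_iff _).2 hϖ0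
  have hσϖ0 : σ ϖ ≠ 0 := (map_ne_zero σ).2 hϖ0
  have hpw : ∀ a b : ℕ, Valued.v ϖ ^ a ≤ Valued.v ϖ ^ b ↔ b ≤ a := fun a b => by
    rw [v_varpi_pow hϖ, v_varpi_pow hϖ, WithZero.exp_le_exp]; omega
  have hpwi : ∀ a b : ℕ, Valued.v ϖ ^ a = Valued.v ϖ ^ b ↔ a = b := fun a b => by
    rw [v_varpi_pow hϖ, v_varpi_pow hϖ, WithZero.exp_inj]; omega
  obtain ⟨hαn, hβn, -, -, -, h₁, h₂, h₃, hN1, hN2, hN3⟩ := id hE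
  have hmcN : mcOfRecord d ≤ n0DerivedOfRecord d := mcOfRecord_le_n0DerivedOfRecord d
  have hmcv : mcOfRecord d = 2 * ((d % 2 + 2 * d - 1 + d) / 2) := rfl
  -- named scalars
  have hπ0 : ((ϖ * σ ϖ) ^ (ρ + t') : K) ≠ 0 := pow_ne_zero _ (mul_ne_zero hϖ0 hσϖ0)
  have hσπ : σ ((ϖ * σ ϖ) ^ (ρ + t')) = (ϖ * σ ϖ) ^ (ρ + t') := by rw [map_pow, map_mul, hσ, mul_comm]
  have hvπ : Valued.v ((ϖ * σ ϖ) ^ (ρ + t')) = Valued.v ϖ ^ (2 * ρ + 2 * t') := by rw [map_pow, map_mul, hvσ, ← pow_two, ← pow_mul]; congr 1; ring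
  have htp0 : (ϖ - σ ϖ) * ((ϖ * σ ϖ) ^ ((d - d % 2) / 2))⁻¹ ≠ 0 := refSkewScalar_ne_zero hvσ hϖ hdd
  have hvtp : Valued.v ((ϖ - σ ϖ) * ((ϖ * σ ϖ) ^ ((d - d % 2) / 2))⁻¹) = Valued.v ϖ ^ (d % 2) := by rw [v_refSkewScalar hvσ hϖ hdd, v_varpi_pow hϖ]
  obtain ⟨tp, htpdef⟩ : ∃ tp : K, tp = (ϖ - σ ϖ) * ((ϖ * σ ϖ) ^ ((d - d % 2) / 2))⁻¹ := ⟨_, rfl⟩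
  rw [← htpdef] at htp0 hvtp heB ⊢
  obtain ⟨π, hπdef⟩ : ∃ π : K, π = (ϖ * σ ϖ) ^ (ρ + t') := ⟨_, rfl⟩
  rw [← hπdef] at hπ0 hσπ hvπ heB ⊢
  set gβ : K := eB * π with hgβdef
  have heB0 : eB ≠ 0 := fun h => by rw [h, map_zero] at heB1; exact zero_ne_one heB1
  have hgβ0 : gβ ≠ 0 := mul_ne_zero heB0 hπ0
  have hσgβ : σ gβ = gβ := by rw [hgβdef, map_mul, hσeB, hσπ]
  have hvgβ : Valued.v gβ = Valued.v ϖ ^ (2 * ρ + 2 * t') := by rw [hgβdef, map_mul, heB1, one_mul, hvπ]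
  -- the `β`-error
  have hprecβ : Valued.v ((ϖ ^ (d % 2 + 2 * d - 1))⁻¹ * (π⁻¹ * ((β - 1) - gβ * tp))) ≤ 1 := by
    rw [show (ϖ ^ (d % 2 + 2 * d - 1))⁻¹ * (π⁻¹ * ((β - 1) - gβ * tp)) = (ϖ ^ (d % 2 + 2 * d - 1))⁻¹ * ((β - 1) * π⁻¹ - eB * tp) by rw [hgβdef]; field_simp]
    exact heB
  have heβ : Valued.v ((β - 1) - gβ * tp) ≤ Valued.v ϖ ^ (d % 2 + 2 * d - 1 + 2 * ρ + 2 * t') := by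
    have h := hprecβ
    rw [map_mul, map_mul, map_inv₀, map_inv₀, map_pow, hvπ, inv_mul_le_iff₀ (pow_pos hvϖ _), mul_one, inv_mul_le_iff₀ (pow_pos hvϖ _), ← pow_add] at h
    rwa [show 2 * ρ + 2 * t' + (d % 2 + 2 * d - 1) = d % 2 + 2 * d - 1 + 2 * ρ + 2 * t' by ring] at h
  -- `g_α`
  obtain ⟨gα, hσgα, hgα0⟩ := exists_fixed_mul_refSkew_near_sub_one hσ hvσ hfix hϖ hdd ht₂ hαn h₂ (m := d % 2 + 2 * d - 1 + 2 * ρ) (by omega)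
  rw [← htpdef] at hgα0
  have heα : Valued.v ((α - 1) - gα * tp) ≤ Valued.v ϖ ^ (d % 2 + 2 * d - 1 + 2 * ρ) := by
    have h := hgα0
    rw [map_mul, map_inv₀, map_pow] at h
    rwa [inv_mul_le_iff₀ (pow_pos hvϖ _), mul_one] at h
  have hvgαtp : Valued.v (gα * tp) = Valued.v ϖ ^ n₂ := by
    have hlt : Valued.v ((α - 1) - gα * tp) < Valued.v (α - 1) := by
      rw [h₂]; exact heα.trans_lt (by rw [v_varpi_pow hϖ, v_varpi_pow hϖ, WithZero.exp_lt_exp]; omega)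
    rw [← h₂, ← Valuation.map_sub_eq_of_lt_left Valued.v hlt, sub_sub_cancel]
  have hvgα : Valued.v gα = Valued.v ϖ ^ (n₂ - d % 2) := by
    have h := hvgαtp
    rw [map_mul, hvtp] at h
    rw [show n₂ = (n₂ - d % 2) + d % 2 by omega, pow_add] at h
    exact mul_right_cancel₀ (pow_ne_zero _ hvϖ.ne') h
  -- the ratio
  refine ⟨gα / gβ, by rw [map_div₀, hσgα, hσgβ], hprecβ, fun g hg => ⟨?_, ?_⟩, ?_, fun hA => ?_, fun hB => ?_⟩
  · -- (i) precision of `g_α = r·g_β` at `π⁻¹g`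
    rw [div_mul_cancel₀ gα hgβ0, show (ϖ ^ (d % 2 + 2 * d - 1))⁻¹ * (π⁻¹ * g * ((α - 1) - gα * tp)) =
        (π⁻¹ * g * ϖ ^ (2 * ρ)) * ((ϖ ^ (d % 2 + 2 * d - 1 + 2 * ρ))⁻¹ * ((α - 1) - gα * tp)) by field_simp; ring, map_mul]
    have hunit : Valued.v (π⁻¹ * g * ϖ ^ (2 * ρ)) = 1 := by
      rw [map_mul, map_mul, map_inv₀, hvπ, hg, map_pow, mul_assoc, ← pow_add, show 2 * t' + 2 * ρ = 2 * ρ + 2 * t' by ring,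
        inv_mul_cancel₀ (pow_ne_zero _ hvϖ.ne')]
    rw [hunit, one_mul]; exact hgα0
  · -- (ii) `|rg| = |ϖ|^{n₂ − ℓ₀ − 2ρ}`
    have h : Valued.v (gα / gβ * g) * Valued.v ϖ ^ (2 * ρ + 2 * t') = Valued.v ϖ ^ (n₂ - d % 2 - 2 * ρ) * Valued.v ϖ ^ (2 * ρ + 2 * t') := by
      rw [map_mul, map_div₀, hvgα, hvgβ, hg, div_mul_eq_mul_div, div_mul_cancel₀ _ (pow_ne_zero _ hvϖ.ne'), ← pow_add, ← pow_add, hpwi]; omega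
    exact mul_right_cancel₀ (pow_ne_zero _ hvϖ.ne') h
  · rw [map_div₀, hvgα, hvgβ, div_mul_eq_mul_div, div_eq_iff (pow_ne_zero _ hvϖ.ne'), ← pow_add, ← pow_add, hpwi]; omega
  · -- (iii-A)
    have hdiff : (gα / gβ - 1) * gβ * tp = (α - β) - (((α - 1) - gα * tp) - ((β - 1) - gβ * tp)) := by
      rw [sub_mul, sub_mul, div_mul_cancel₀ gα hgβ0]; ring
    have herrs : Valued.v (((α - 1) - gα * tp) - ((β - 1) - gβ * tp)) ≤ Valued.v ϖ ^ (d % 2 + 2 * d - 1 + 2 * ρ) :=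
      (Valuation.map_sub _ _ _).trans (max_le heα (heβ.trans ((hpw (d % 2 + 2 * d - 1 + 2 * ρ + 2 * t') (d % 2 + 2 * d - 1 + 2 * ρ)).2 (by omega))))
    have hlt : Valued.v (((α - 1) - gα * tp) - ((β - 1) - gβ * tp)) < Valued.v (α - β) := by
      rw [h₃]; exact herrs.trans_lt (by rw [v_varpi_pow hϖ, v_varpi_pow hϖ, WithZero.exp_lt_exp]; omega)
    have hmain : Valued.v ((gα / gβ - 1) * gβ * tp) = Valued.v ϖ ^ n₃ := by rw [hdiff, Valuation.map_sub_eq_of_lt_left Valued.v hlt, h₃]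
    rw [map_mul, map_mul, hvgβ, hvtp] at hmain
    have h : Valued.v (gα / gβ - 1) * Valued.v ϖ ^ (2 * t') * Valued.v ϖ ^ (2 * ρ + d % 2) = Valued.v ϖ ^ (n₃ - d % 2 - 2 * ρ) * Valued.v ϖ ^ (2 * ρ + d % 2) := by
      rw [← pow_add, show n₃ - d % 2 - 2 * ρ + (2 * ρ + d % 2) = n₃ by omega, ← hmain, mul_assoc, mul_assoc, ← pow_add, ← pow_add]
      congr 2; ring
    exact mul_right_cancel₀ (pow_ne_zero _ hvϖ.ne') h
  · -- (iii-B)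
    have hdiff : (gα / gβ - 1) * gβ * tp = (α - β) - (((α - 1) - gα * tp) - ((β - 1) - gβ * tp)) := by
      rw [sub_mul, sub_mul, div_mul_cancel₀ gα hgβ0]; ring
    have herrs : Valued.v (((α - 1) - gα * tp) - ((β - 1) - gβ * tp)) ≤ Valued.v ϖ ^ (d % 2 + 2 * d - 1 + 2 * ρ) :=
      (Valuation.map_sub _ _ _).trans (max_le heα (heβ.trans ((hpw (d % 2 + 2 * d - 1 + 2 * ρ + 2 * t') (d % 2 + 2 * d - 1 + 2 * ρ)).2 (by omega))))
    have hmain : Valued.v ((gα / gβ - 1) * gβ * tp) ≤ Valued.v ϖ ^ (d % 2 + 2 * d - 1 + 2 * ρ) := by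
      rw [hdiff]; exact (Valuation.map_sub _ _ _).trans (max_le (by rw [h₃, hpw]; exact hB) herrs)
    rw [map_mul, map_mul, hvgβ, hvtp] at hmain
    have h : Valued.v (gα / gβ - 1) * Valued.v ϖ ^ (2 * t') * Valued.v ϖ ^ (2 * ρ + d % 2) ≤ Valued.v ϖ ^ (2 * d - 1) * Valued.v ϖ ^ (2 * ρ + d % 2) := by
      rw [← pow_add, show 2 * d - 1 + (2 * ρ + d % 2) = d % 2 + 2 * d - 1 + 2 * ρ by omega]
      refine le_of_eq_of_le ?_ hmain
      rw [mul_assoc, mul_assoc, ← pow_add, ← pow_add]; congr 2; ring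
    exact le_of_mul_le_mul_right h (pow_pos hvϖ _)

/-! ## §5  The per-orbit value on the tube beyond the cell, and the sign of `g_β·x` -/

open Classical in
/-- **THE PER-ORBIT VALUE ON A REPRESENTATIVE** (★ FILE 5a `labelledOdd_div_relIndex_glued_rep_beyond_eq`, fed with §1–§2: the representative is in the stratum, on the shell, `T`-stable,
its orbit finite; square level `mcOfRecord d`; twist depth `2j₁ = n₂ − ℓ₀ − 2ρ`). [cite: Kottwitz1986BaseChangeUnits, §1 pp. 240–241] [cite: Rogawski1990, §4.9 Prop. 4.9.1 (b) p. 55] -/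
theorem value_latt_glued_rep_eq (h2 : Valued.v (2 : K) < 1) (hD : IsRamifiedQuadraticDatum σ ϖ d t) (hE : IsElementDatum σ ϖ (n0DerivedOfRecord d) α β n₁ n₂ n₃)
    (T : GL (Fin 3) K) (hT : (T : Matrix (Fin 3) (Fin 3) K) = Matrix.diagonal ![α, β, 1]) (ρ t' : ℕ) (hρ : 1 ≤ ρ) (ht' : 1 ≤ t')
    (hread : 2 * ρ + 2 * t' + d % 2 = n₁) (hcap : 2 * ρ + 2 + d % 2 ≤ min n₂ n₃)
    {g : K} (hσg : σ g = g) (hg : Valued.v g = Valued.v ϖ ^ (2 * t'))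
    (V : GL (Fin 3) K) (hV : (V : Matrix (Fin 3) (Fin 3) K) = !![1, 0, 0; 1, ϖ ^ ρ, 0; 1 * 1 + g, ϖ ^ ρ * 1, ϖ ^ (2 * ρ + 2 * t')])
    {r gβ : K} (hσr : σ r = r) (hσgβ : σ gβ = gβ) (hgβ0 : gβ ≠ 0)
    (hgα : Valued.v ((ϖ ^ (d % 2 + 2 * d - 1))⁻¹ * (((ϖ * σ ϖ) ^ (ρ + t'))⁻¹ * g * ((α - 1) - r * gβ * ((ϖ - σ ϖ) * ((ϖ * σ ϖ) ^ ((d - d % 2) / 2))⁻¹)))) ≤ 1)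
    (hgβ : Valued.v ((ϖ ^ (d % 2 + 2 * d - 1))⁻¹ * (((ϖ * σ ϖ) ^ (ρ + t'))⁻¹ * ((β - 1) - gβ * ((ϖ - σ ϖ) * ((ϖ * σ ϖ) ^ ((d - d % 2) / 2))⁻¹)))) ≤ 1)
    (j₁ : ℕ) (hj₁ : n₂ = 2 * ρ + 2 * j₁ + d % 2) (hrg : Valued.v (r * g) = Valued.v ϖ ^ (2 * j₁)) (i : Fin 3) :
    (labelledOddCount σ ϖ 0 i (valueClassLabel σ ϖ (α - 1) (β - 1) (d % 2 + 2 * d - 1) d) (latt (V : Matrix (Fin 3) (Fin 3) K)) : ℚ) /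
        ((((unitStabilizer (latt (V : Matrix (Fin 3) (Fin 3) K))).map (unitNormMap σ 3)).relIndex (fixedUnitTorus σ 3) : ℕ) : ℚ) =
      (normSign σ (gβ * (1 + r * g)) : ℚ) * ((![normSign σ g, 1, normSign σ (-1) * normSign σ (1 + g)] : Fin 3 → ℤ) i : ℚ) / 2 *
        ((if ∀ u ∈ fixedUnitStabilizer σ (latt (V : Matrix (Fin 3) (Fin 3) K)),
              normSign σ ((u i : Kˣ) : K) * (normSign σ ((u 1 : Kˣ) : K) * normSign σ (1 + r * g / (1 + r * g) * (((u 0 : Kˣ) : K) / ((u 1 : Kˣ) : K) - 1))) = 1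
            then 1 else 0 : ℤ) : ℚ) *
        stabiliserWeight σ (latt (V : Matrix (Fin 3) (Fin 3) K)) := by
  obtain ⟨hσ, hvσ, hϖ, -, -, -, -⟩ := id hD
  have hd2 : 2 ≤ d := two_le_d_of_v_two_lt_one hD h2
  obtain ⟨-, -, -, -, -, -, -, -, hN1, hN2, hN3⟩ := id hE
  have hmcN : mcOfRecord d ≤ n0DerivedOfRecord d := mcOfRecord_le_n0DerivedOfRecord d
  have hmcv : mcOfRecord d = 2 * ((d % 2 + 2 * d - 1 + d) / 2) := rfl
  obtain ⟨hstab, hM⟩ := latt_glued_rep_mem_stratum_beyond hD hE T hT ρ t' hρ ht' hread hcap hσg hg V hV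
  obtain ⟨hlev, hnlev, hsq⟩ := shell_of_mem_stratum_G1_beyond hD hE T ρ (2 * t') hρ (by omega) hread hcap hM
  exact labelledOdd_div_relIndex_glued_rep_beyond_eq hD hρ ht' hσg hg V hV hM.1.2.2
    (finite_unitTorus_orbit_of_mem_normalisedStableLattices hϖ (v_diag_eq_one hvσ hE) (diag_regular hE) T hT hM.1) hE (mc := mcOfRecord d)
    (by omega) (by omega) (by omega) (by omega) hlev hnlev hsq hT hstab hσr hσgβ hgβ0 hgα hgβ (Δ := 2 * j₁) (by omega) hrg (by omega) i

/-- **`ω(e_B·π₀^k·x) = ω(e_B)·ω(x)`** for fixed `e_B ≠ 0`, `x ≠ 0` (`π₀^k = ϖ^k·σ(ϖ^k)` is a norm; `ω` is multiplicative on fixed elements, ★ `normSign_mul_of_fixed`).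
[cite: Serre1979, Ch. V §3 Cor. 3; Ch. XV §2] -/
theorem normSign_unit_mul_normPow_mul (hD : IsRamifiedQuadraticDatum σ ϖ d t) {eB x : K} (hσeB : σ eB = eB) (heB1 : Valued.v eB = 1)
    (hσx : σ x = x) (hx0 : x ≠ 0) (k : ℕ) :
    (normSign σ (eB * (ϖ * σ ϖ) ^ k * x) : ℚ) = normSign σ eB * normSign σ x := by
  obtain ⟨-, -, hϖ, -, -, -, -⟩ := id hD
  have hϖ0 : ϖ ≠ 0 := (ne_zero_and_v_lt_one_of_v_eq_exp hϖ).1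
  have heB0 : eB ≠ 0 := fun h => by rw [h, map_zero] at heB1; exact zero_ne_one heB1
  rw [show eB * (ϖ * σ ϖ) ^ k * x = (eB * x) * (ϖ ^ k * σ (ϖ ^ k)) by rw [map_pow, ← mul_pow]; ring,
    normSign_mul_norm σ _ (pow_ne_zero _ hϖ0), normSign_mul_of_fixed hD hσeB hσx heB0 hx0]
  simp only [Int.cast_mul]

end Summit.HodgeConjecture.HodgeConjecture.Cruxes.H413.F0P3cDyRamLabelledOddBoundaryG1Orbits

end
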